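/-
Copyright: the b2b-balaban T⁴-continuum CRUX team, row NE7b OWNER lineage `t4-ne7b-p1` (gen 136). Project licence.
-/
import Summits.QuantumFields.BalabanUV.T4Continuum.Spine.NE7b.SupGaussianQuadraticAbsorption
import Summits.QuantumFields.BalabanUV.T4Continuum.Spine.NE7b.SupDressedCovarianceLetters
import Summits.QuantumFields.BalabanUV.T4Continuum.Spine.NE7b.SupNextHessianMatrix

/-!
# THE MEAN SHIFT OF THE DRESSED STEP IS A SMALL TRANSLATION OF THE BACKGROUND — (α4), THE LINEAR PART'S FATE: the dressed step (390)
# hands the next integration to the SHIFTED Gaussian `N(m, S′)`, `m = −S′b_D`, `S′ = (S⁻¹+K)⁻¹`; this file records the three facts that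
# turn it back into the road's CENTRED format: (i) translation, `∫G dN(m,S′) = ∫G(·+m) dN(0,S′)` for EVERY `G` — the shift moves the
# background `ψ₀ ↦ ψ₀ + m`; (ii) the shift is CONTROLLED by the dressed coercivity, `‖S′b‖ ≤ γ⁺‖b‖`, `γ⁺ = γ′∕(1−kγ′)` ((387)); (iii) the
# road's extracted linear part `b_D(ψ₀)` VANISHES off the cells and, with a per-site letter `|b_D(y)| ≤ β` on the cells ((315): `β = O(ε)`),
# has `‖b_D‖ ≤ β√#Y`, so `‖m‖ ≤ γ⁺β√#Y` — an `O(ε)` translation (row NE7b, node U5c; (385)∕(387)∕(388) + `GaussianToolkit` BY NAME;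
# [folklore])

Cell `pub-balaban`, sub-cell `t4`, spine estimate NE7b (`T4WeightBudget.RelWeightBound`; the cell's OWN estimate — NOT PRINTED in
[Bałaban 1983–89], NOT PROVED).  Crux-route work under `Spine/NE7b/` by the row OWNER (`t4-ne7b-p1` gen 136, file (392)) under FREEZE
(0)'s crux-prover clause, on this gen's SCOPING-d8 DECISION (1) («(β2) the mean shift»); NOTHING of Bałaban's is named as a Lean object,
valued or asserted; no `T4Continuum/Support` leaf typed; no `def`, no notation (`b_D` WRITTEN OUT as in (388)); zero `sorry`.  Imports (BY
NAME): the OWNER's (385) (`multivariateGaussian_map_add`), (387) (`dressed_precision_coercive`, `dressed_precision_posDef`), (388)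
(`nextGradient_apply`), the tree's `GaussianToolkit` (`norm_inv_mulVec_le`); Mathlib's `integral_map_equiv`, `EuclideanSpace.real_norm_sq_eq`.

WHAT IS PROVED ([folklore]):
* §1 **`integral_shifted_gaussian`** (`∫G dN(m,S′) = ∫G(ζ+m) dN(0,S′)`, every `G`, any `m, S′`);
* §2 `norm_toLp_sq_eq_dot`, **`dressed_shift_norm_le`** (`S ≻ 0`, `γ′·1 − S ⪰ 0`, `0 < γ′`, `K + k·1 ⪰ 0`, `kγ′ < 1` ⟹
  `‖(S⁻¹+K)⁻¹b‖ ≤ γ′∕(1−kγ′)·‖b‖`);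
* §3 `dot_self_le_card_mul_sq` (`b = 0` off `Y`, `|b| ≤ β` on `Y` ⟹ `b·b ≤ #Y·β²`), `dot_ofLp_single_one`, **`nextGradient_eq_zero_off`** (`b_D(ψ₀)(y) = 0` for
  `y ∉ ⋃cells`), **`dressed_shift_small`** (THE END: `|b_D(y)| ≤ β` on the cells ⟹ `‖(S⁻¹+K)⁻¹b_D‖ ≤ γ′∕(1−kγ′)·β·√#Y`); §4 toy.

HONEST (what this is NOT).  Bookkeeping of the linear part: the per-site letter `β` is (315)'s (`2(Δ+1)2e·ε̃A^v`, under its KP smallness) and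
is a HYPOTHESIS here; after the translation the residual `r` of (389)∕(391) is evaluated at `ζ′ + m`, so the next small-field ball shrinks by
`‖m‖` (Minkowski — the successor's line); no contraction; scalar skeleton ((A3), NC-NE7b-α UNRULED); nothing of Bałaban's asserted.  BY-NAME
EFFECT ON THE WALL: NONE.  NE7b NOT PRINTED ∕ NOT PROVED; spine PROVED 0∕9; rung (B)+1 — the programme's measures remain FINITE-torus statements;
NOT the mass gap, NOT Clay.  HONEST DEPENDENCY: continuum YM on T⁴ ⇐ BetaPertH ∧ nine spine estimates (0∕9 proved); BetaPertH ⇐ (D1) ∧ (D4) ∧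
CAP+tail; G-an2-4 gates asym, D1 and NE2∕3∕4.
-/

set_option autoImplicit false
set_option maxSynthPendingDepth 2

noncomputable section

namespace Summit.QuantumFields.BalabanUV.T4Continuum.NE7b.SupDressedMeanShift

open MeasureTheory ProbabilityTheory Finset Real Matrix
open scoped BigOperators
open SupGaussianQuadraticAbsorption (multivariateGaussian_map_add)
open SupDressedCovarianceLetters (dressed_precision_coercive dressed_precision_posDef)
open SupNextHessianMatrix (nextGradient_apply)
open Literature.MathematicalPhysics.QuantumFieldTheory.GaussianToolkit (norm_inv_mulVec_le)

variable {ι : Type} [Fintype ι] [DecidableEq ι] {V : Type*}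

/-! ## §1. Translation: the shifted Gaussian is the centred one composed with `ζ ↦ ζ + m` -/

/-- **`∫G dN(m,S′) = ∫G(ζ + m) dN(0,S′)`** for EVERY `G` (no measurability needed: `ζ ↦ ζ + m` is a measurable equivalence). [folklore] -/
theorem integral_shifted_gaussian {G : Type*} [NormedAddCommGroup G] [NormedSpace ℝ G] (m : EuclideanSpace ℝ ι) (S' : Matrix ι ι ℝ)
    (F : EuclideanSpace ℝ ι → G) :
    ∫ ζ, F ζ ∂(multivariateGaussian m S') = ∫ ζ, F (ζ + m) ∂(multivariateGaussian 0 S') := by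
  rw [← multivariateGaussian_map_add m S', ← MeasurableEquiv.coe_addRight, integral_map_equiv]
  rfl

/-! ## §2. The shift is controlled by the dressed coercivity -/

omit [DecidableEq ι] in
/-- `‖v‖² = v·v` on `ℝ^ι`. [folklore] -/
theorem norm_toLp_sq_eq_dot (v : ι → ℝ) : ‖(WithLp.toLp 2 v : EuclideanSpace ℝ ι)‖ ^ 2 = v ⬝ᵥ v := by
  rw [EuclideanSpace.real_norm_sq_eq]
  simp only [dotProduct, pow_two]

/-- **THE DRESSED SHIFT IS CONTROLLED**: `S ≻ 0`, `γ′·1 − S ⪰ 0`, `0 < γ′`, `K + k·1 ⪰ 0`, `kγ′ < 1` ⟹ for every `b`,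
`‖(S⁻¹+K)⁻¹b‖ ≤ γ′∕(1−kγ′)·‖b‖`. [folklore] -/
theorem dressed_shift_norm_le {S K : Matrix ι ι ℝ} {γ' k : ℝ} (hS : S.PosDef) (hSγ : (γ' • (1 : Matrix ι ι ℝ) - S).PosSemidef)
    (hγ' : 0 < γ') (hK : (K + k • (1 : Matrix ι ι ℝ)).PosSemidef) (hkγ : k * γ' < 1) (b : ι → ℝ) :
    ‖(WithLp.toLp 2 ((S⁻¹ + K)⁻¹ *ᵥ b) : EuclideanSpace ℝ ι)‖ ≤ γ' / (1 - k * γ') * ‖(WithLp.toLp 2 b : EuclideanSpace ℝ ι)‖ := by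
  have hQ := dressed_precision_posDef hS hSγ hγ' hK hkγ
  have h1γ : 0 < 1 - k * γ' := by linarith
  have hc : 0 < γ'⁻¹ - k := by
    have : γ'⁻¹ - k = (1 - k * γ') / γ' := by field_simp
    rw [this]; exact div_pos h1γ hγ'
  have hlow : ∀ v : ι → ℝ, (γ'⁻¹ - k) * ‖(WithLp.toLp 2 v : EuclideanSpace ℝ ι)‖ ^ 2 ≤ v ⬝ᵥ (S⁻¹ + K) *ᵥ v := fun v => by
    rw [norm_toLp_sq_eq_dot]; exact dressed_precision_coercive hS hSγ hγ' hK v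
  have h := norm_inv_mulVec_le hQ hc hlow b
  have hcinv : ‖(WithLp.toLp 2 b : EuclideanSpace ℝ ι)‖ / (γ'⁻¹ - k) = γ' / (1 - k * γ') * ‖(WithLp.toLp 2 b : EuclideanSpace ℝ ι)‖ := by
    have : γ'⁻¹ - k = (1 - k * γ') / γ' := by field_simp
    rw [this, div_div_eq_mul_div]
    ring
  rw [hcinv] at h
  exact h

/-! ## §3. The road's linear part vanishes off the cells and is small on them -/

omit [DecidableEq ι] in
/-- `b = 0` off `Y` and `|b_y| ≤ β` on `Y` ⟹ `b·b ≤ #Y·β²`. [folklore] -/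
theorem dot_self_le_card_mul_sq (Y : Finset ι) {b : ι → ℝ} {β : ℝ} (hoff : ∀ y, y ∉ Y → b y = 0) (hon : ∀ y ∈ Y, |b y| ≤ β) :
    b ⬝ᵥ b ≤ Y.card * β ^ 2 := by
  classical
  have e : b ⬝ᵥ b = ∑ y ∈ Y, b y * b y := by
    rw [dotProduct]
    refine (Finset.sum_subset (Finset.subset_univ Y) fun y _ hy => ?_).symm
    rw [hoff y hy, mul_zero]
  rw [e]
  calc ∑ y ∈ Y, b y * b y ≤ ∑ y ∈ Y, β ^ 2 := Finset.sum_le_sum fun y hy => by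
          have h := hon y hy
          have : b y * b y = |b y| ^ 2 := by rw [sq_abs, pow_two]
          rw [this]
          exact pow_le_pow_left₀ (abs_nonneg _) h 2
    _ = Y.card * β ^ 2 := by rw [Finset.sum_const, nsmul_eq_mul]

/-- `b · e_y = b_y` for the coordinate vector `e_y` of `ℝ^ι`. [folklore] -/
theorem dot_ofLp_single_one (b : ι → ℝ) (y : ι) : b ⬝ᵥ WithLp.ofLp (EuclideanSpace.single y (1 : ℝ)) = b y := by
  simp [dotProduct]

section Road

variable {Γ : Matrix ι ι ℝ} {γop : ℝ} {cell : V → Finset ι} {w w' : ι → ℝ → ℝ} {κ₀ κ₁ τ δ θ : ℝ}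

/-- **THE EXTRACTED LINEAR PART VANISHES OFF THE CELLS**: for `y ∉ ⋃_{p∈C} cell p`, `b_D(ψ₀)(y) = 0`. [folklore] -/
theorem nextGradient_eq_zero_off (hΓ : Γ.PosSemidef) (hΓop : (γop • (1 : Matrix ι ι ℝ) - Γ).PosSemidef)
    (hdisj : ∀ p q, p ≠ q → Disjoint (cell p) (cell q)) (hw' : ∀ x t, HasDerivAt (w x) (w' x t) t) (hw'm : ∀ x, Measurable (w' x))
    (hκ₀ : 0 ≤ κ₀) (hκ₁ : 0 ≤ κ₁) (hτ : 0 < τ) (hδ : 0 < δ) (hθ1 : θ < 1)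
    (hκθ : (2 * κ₀ * (1 + τ) + 4 * δ) * γop ≤ θ) (hstab : ∀ x, ∀ t : ℝ, -(κ₀ * t ^ 2) ≤ w x t)
    (hw'b : ∀ x t, |w' x t| ≤ κ₁ * |t|) (C : Finset V) (ψ₀ : EuclideanSpace ℝ ι) {y : ι} (hy : y ∉ C.biUnion cell) :
    (fun x : ι => ((∫ ω : EuclideanSpace ℝ ι, exp (-(∑ p ∈ C, ∑ x ∈ cell p, w x (ω x + ψ₀ x))) ∂(multivariateGaussian 0 Γ))⁻¹ •
        ∫ ω : EuclideanSpace ℝ ι, exp (-(∑ p ∈ C, ∑ x ∈ cell p, w x (ω x + ψ₀ x))) •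
          (∑ p ∈ C, ∑ x ∈ cell p, (w' x (ω x + ψ₀ x)) • (EuclideanSpace.proj x : EuclideanSpace ℝ ι →L[ℝ] ℝ))
          ∂(multivariateGaussian 0 Γ)) (EuclideanSpace.single x (1 : ℝ))) y = 0 := by
  have h := nextGradient_apply hΓ hΓop hdisj hw' hw'm hκ₀ hκ₁ hτ hδ hθ1 hκθ hstab hw'b C ψ₀ (EuclideanSpace.single y (1 : ℝ))
  rw [dot_ofLp_single_one] at h
  dsimp only
  rw [h]
  have hzero : ∀ ω : EuclideanSpace ℝ ι,
      ∑ p ∈ C, ∑ x ∈ cell p, w' x (ω x + ψ₀ x) * (EuclideanSpace.single y (1 : ℝ) : EuclideanSpace ℝ ι) x = 0 := fun ω => by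
    refine Finset.sum_eq_zero fun p hp => Finset.sum_eq_zero fun x hx => ?_
    have hxy : x ≠ y := fun e => hy (Finset.mem_biUnion.2 ⟨p, hp, e ▸ hx⟩)
    have hsx : (EuclideanSpace.single y (1 : ℝ) : EuclideanSpace ℝ ι) x = 0 := by simp [hxy]
    rw [hsx, mul_zero]
  simp only [hzero, mul_zero, integral_zero]

/-- **THE END — THE DRESSED SHIFT OF THE ROAD IS `O(β)`**: with this step's data as in (388) `nextGradient_apply`, a per-site letter
`|b_D(ψ₀)(y)| ≤ β` on `⋃_{p∈C}cell p` (supplied by (315)), and the next covariance `S ≻ 0`, `γ′·1 − S ⪰ 0`, `0 < γ′`, `K + k·1 ⪰ 0`, `kγ′ < 1`: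
`‖(S⁻¹+K)⁻¹b_D(ψ₀)‖ ≤ γ′∕(1−kγ′)·β·√#(⋃cells)`. [folklore] -/
theorem dressed_shift_small (hΓ : Γ.PosSemidef) (hΓop : (γop • (1 : Matrix ι ι ℝ) - Γ).PosSemidef)
    (hdisj : ∀ p q, p ≠ q → Disjoint (cell p) (cell q)) (hw' : ∀ x t, HasDerivAt (w x) (w' x t) t) (hw'm : ∀ x, Measurable (w' x))
    (hκ₀ : 0 ≤ κ₀) (hκ₁ : 0 ≤ κ₁) (hτ : 0 < τ) (hδ : 0 < δ) (hθ1 : θ < 1)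
    (hκθ : (2 * κ₀ * (1 + τ) + 4 * δ) * γop ≤ θ) (hstab : ∀ x, ∀ t : ℝ, -(κ₀ * t ^ 2) ≤ w x t)
    (hw'b : ∀ x t, |w' x t| ≤ κ₁ * |t|) (C : Finset V) (ψ₀ : EuclideanSpace ℝ ι) {β : ℝ} (hβ : 0 ≤ β)
    (hon : ∀ y ∈ C.biUnion cell, |(fun x : ι => ((∫ ω : EuclideanSpace ℝ ι, exp (-(∑ p ∈ C, ∑ x ∈ cell p, w x (ω x + ψ₀ x))) ∂(multivariateGaussian 0 Γ))⁻¹ •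
        ∫ ω : EuclideanSpace ℝ ι, exp (-(∑ p ∈ C, ∑ x ∈ cell p, w x (ω x + ψ₀ x))) •
          (∑ p ∈ C, ∑ x ∈ cell p, (w' x (ω x + ψ₀ x)) • (EuclideanSpace.proj x : EuclideanSpace ℝ ι →L[ℝ] ℝ))
          ∂(multivariateGaussian 0 Γ)) (EuclideanSpace.single x (1 : ℝ))) y| ≤ β)
    {S K : Matrix ι ι ℝ} {γ' k : ℝ} (hS : S.PosDef) (hSγ : (γ' • (1 : Matrix ι ι ℝ) - S).PosSemidef) (hγ' : 0 < γ')
    (hK : (K + k • (1 : Matrix ι ι ℝ)).PosSemidef) (hkγ : k * γ' < 1) :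
    ‖(WithLp.toLp 2 ((S⁻¹ + K)⁻¹ *ᵥ (fun x : ι => ((∫ ω : EuclideanSpace ℝ ι, exp (-(∑ p ∈ C, ∑ x ∈ cell p, w x (ω x + ψ₀ x))) ∂(multivariateGaussian 0 Γ))⁻¹ •
        ∫ ω : EuclideanSpace ℝ ι, exp (-(∑ p ∈ C, ∑ x ∈ cell p, w x (ω x + ψ₀ x))) •
          (∑ p ∈ C, ∑ x ∈ cell p, (w' x (ω x + ψ₀ x)) • (EuclideanSpace.proj x : EuclideanSpace ℝ ι →L[ℝ] ℝ))
          ∂(multivariateGaussian 0 Γ)) (EuclideanSpace.single x (1 : ℝ)))) : EuclideanSpace ℝ ι)‖ ≤ γ' / (1 - k * γ') * (β * Real.sqrt (C.biUnion cell).card) := by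
  have h1 := dressed_shift_norm_le hS hSγ hγ' hK hkγ (fun x : ι => ((∫ ω : EuclideanSpace ℝ ι, exp (-(∑ p ∈ C, ∑ x ∈ cell p, w x (ω x + ψ₀ x))) ∂(multivariateGaussian 0 Γ))⁻¹ •
        ∫ ω : EuclideanSpace ℝ ι, exp (-(∑ p ∈ C, ∑ x ∈ cell p, w x (ω x + ψ₀ x))) •
          (∑ p ∈ C, ∑ x ∈ cell p, (w' x (ω x + ψ₀ x)) • (EuclideanSpace.proj x : EuclideanSpace ℝ ι →L[ℝ] ℝ))
          ∂(multivariateGaussian 0 Γ)) (EuclideanSpace.single x (1 : ℝ)))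
  have hoff : ∀ y, y ∉ C.biUnion cell → (fun x : ι => ((∫ ω : EuclideanSpace ℝ ι, exp (-(∑ p ∈ C, ∑ x ∈ cell p, w x (ω x + ψ₀ x))) ∂(multivariateGaussian 0 Γ))⁻¹ •
        ∫ ω : EuclideanSpace ℝ ι, exp (-(∑ p ∈ C, ∑ x ∈ cell p, w x (ω x + ψ₀ x))) •
          (∑ p ∈ C, ∑ x ∈ cell p, (w' x (ω x + ψ₀ x)) • (EuclideanSpace.proj x : EuclideanSpace ℝ ι →L[ℝ] ℝ))
          ∂(multivariateGaussian 0 Γ)) (EuclideanSpace.single x (1 : ℝ))) y = 0 := fun y hy =>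
    nextGradient_eq_zero_off hΓ hΓop hdisj hw' hw'm hκ₀ hκ₁ hτ hδ hθ1 hκθ hstab hw'b C ψ₀ hy
  have hdot := dot_self_le_card_mul_sq (C.biUnion cell) hoff hon
  have hnorm : ‖(WithLp.toLp 2 (fun x : ι => ((∫ ω : EuclideanSpace ℝ ι, exp (-(∑ p ∈ C, ∑ x ∈ cell p, w x (ω x + ψ₀ x))) ∂(multivariateGaussian 0 Γ))⁻¹ •
        ∫ ω : EuclideanSpace ℝ ι, exp (-(∑ p ∈ C, ∑ x ∈ cell p, w x (ω x + ψ₀ x))) •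
          (∑ p ∈ C, ∑ x ∈ cell p, (w' x (ω x + ψ₀ x)) • (EuclideanSpace.proj x : EuclideanSpace ℝ ι →L[ℝ] ℝ))
          ∂(multivariateGaussian 0 Γ)) (EuclideanSpace.single x (1 : ℝ))) : EuclideanSpace ℝ ι)‖ ≤ β * Real.sqrt (C.biUnion cell).card := by
    have hsq := norm_toLp_sq_eq_dot (fun x : ι => ((∫ ω : EuclideanSpace ℝ ι, exp (-(∑ p ∈ C, ∑ x ∈ cell p, w x (ω x + ψ₀ x))) ∂(multivariateGaussian 0 Γ))⁻¹ •
        ∫ ω : EuclideanSpace ℝ ι, exp (-(∑ p ∈ C, ∑ x ∈ cell p, w x (ω x + ψ₀ x))) •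
          (∑ p ∈ C, ∑ x ∈ cell p, (w' x (ω x + ψ₀ x)) • (EuclideanSpace.proj x : EuclideanSpace ℝ ι →L[ℝ] ℝ))
          ∂(multivariateGaussian 0 Γ)) (EuclideanSpace.single x (1 : ℝ)))
    have hn0 : 0 ≤ ‖(WithLp.toLp 2 (fun x : ι => ((∫ ω : EuclideanSpace ℝ ι, exp (-(∑ p ∈ C, ∑ x ∈ cell p, w x (ω x + ψ₀ x))) ∂(multivariateGaussian 0 Γ))⁻¹ •
        ∫ ω : EuclideanSpace ℝ ι, exp (-(∑ p ∈ C, ∑ x ∈ cell p, w x (ω x + ψ₀ x))) •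
          (∑ p ∈ C, ∑ x ∈ cell p, (w' x (ω x + ψ₀ x)) • (EuclideanSpace.proj x : EuclideanSpace ℝ ι →L[ℝ] ℝ))
          ∂(multivariateGaussian 0 Γ)) (EuclideanSpace.single x (1 : ℝ))) : EuclideanSpace ℝ ι)‖ := norm_nonneg _
    have htarget : (β * Real.sqrt (C.biUnion cell).card) ^ 2 = (C.biUnion cell).card * β ^ 2 := by
      rw [mul_pow, Real.sq_sqrt (Nat.cast_nonneg _)]; ring
    have hle : ‖(WithLp.toLp 2 (fun x : ι => ((∫ ω : EuclideanSpace ℝ ι, exp (-(∑ p ∈ C, ∑ x ∈ cell p, w x (ω x + ψ₀ x))) ∂(multivariateGaussian 0 Γ))⁻¹ •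
        ∫ ω : EuclideanSpace ℝ ι, exp (-(∑ p ∈ C, ∑ x ∈ cell p, w x (ω x + ψ₀ x))) •
          (∑ p ∈ C, ∑ x ∈ cell p, (w' x (ω x + ψ₀ x)) • (EuclideanSpace.proj x : EuclideanSpace ℝ ι →L[ℝ] ℝ))
          ∂(multivariateGaussian 0 Γ)) (EuclideanSpace.single x (1 : ℝ))) : EuclideanSpace ℝ ι)‖ ^ 2 ≤ (β * Real.sqrt (C.biUnion cell).card) ^ 2 := by
      rw [htarget, hsq]; exact hdot
    exact (pow_le_pow_iff_left₀ hn0 (by positivity) two_ne_zero).1 hle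
  have h1γ : 0 < 1 - k * γ' := by linarith
  exact h1.trans (mul_le_mul_of_nonneg_left hnorm (div_pos hγ' h1γ).le)

end Road

/-! ## §4. Toy -/

/-- Toy (§3): a vector supported on `∅` has `b·b ≤ 0·β²`. -/
example (b : ι → ℝ) (hb : ∀ y, b y = 0) : b ⬝ᵥ b ≤ (∅ : Finset ι).card * (1 : ℝ) ^ 2 :=
  dot_self_le_card_mul_sq ∅ (fun y _ => hb y) (fun y hy => absurd hy (Finset.notMem_empty y))

end Summit.QuantumFields.BalabanUV.T4Continuum.NE7b.SupDressedMeanShift
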